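import Summits.MatrixMultiplication.MatrixMultiplication.Theses.StabilizerTensorRank
import Literature.Computability.AlgebraicComplexity.MatMulFourRank48Proofs

/-!
# Piece `StabBeatsStrassen` (stmt-MatrixMultiplication-3828, SEED leaf of `OmegaStabTwo`) — birth skeleton
`seed-orbit-test` (crux-strategist, per-piece skeleton of the decomposition of stmt-3827)

The route's CHEAPEST FALSIFIER, typed: the `k = 2` ORBIT TEST on the Dumas–Pernet–Sedoglavic rational
point of `⟨4×4×4 : 48⟩` (tree: `MatMulFour48.U / V / W`, `matMulTensor_four_eq_sum_dumasPernetSedoglavic`,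
kernel-checked Brent equations).

* `stub_isotropy` (de Groote sandwiching, size M, provable): for `P, Q, R ∈ GL₄(ℂ)` with inverses
  `P', Q', R'`, any decomposition `⟨4,4,4⟩ = Σ_s w_s ⊗ u_s ⊗ v_s` transforms into the decomposition with
  legs `P W_s R'`, `P'ᵀ U_s Qᵀ`, `Q'ᵀ V_s Rᵀ` (from `A ↦ P⁻¹ A Q`, `B ↦ Q⁻¹ B R`, `AB ↦ P⁻¹ (AB) R`).
* `stub_orbitPoint` (the finite crux, size L): SOME isotropy `(P, Q, R)` and SOME rescalings
  `α_s, β_s, γ_s ≠ 0` make all `3 · 48 = 144` transformed DPS legs exact stabilizer states of `2 + 2`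
  qubits (bit-reading `legBits 2`).
* `StabBeatsStrassen_of : StabBeatsStrassen` — real proof modulo the two stubs: transform the DPS
  decomposition (stub 1), pull the rescalings into the coefficients (`triad_smul_smul_smul`), reindex
  the `48` products (`hasStabilizerScheme_of_fintype`), `48 < 49 = 7²`.

Probe shape: neither stub is the piece (stub 1 is a true lemma about ALL decompositions; stub 2 is an
existence statement about ONE explicit 48-term scheme) nor the summit.
-/

set_option linter.dupNamespace false

noncomputable section

open scoped BigOperators

namespace Summit.MatrixMultiplication.MatrixMultiplication.Cruxes.OmegaStabTwo.SeedOrbitTest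

open Literature.Computability.AlgebraicComplexity Literature.Computability.QuantumComplexity
open Summit.MatrixMultiplication.MatrixMultiplication.Theses.StabilizerTensorRank

/-! ## The sandwich action on legs (de Groote isotropies of `⟨4,4,4⟩`) -/

/-- Output legs: `W ↦ P W R'` (`R' = R⁻¹`). -/
def sandW (P R' : Matrix (Fin 4) (Fin 4) ℂ) (f : Fin 4 × Fin 4 → ℂ) : Fin 4 × Fin 4 → ℂ :=
  fun a => ∑ i, ∑ j, P a.1 i * f (i, j) * R' j a.2

/-- `A`-legs: `U ↦ P'ᵀ U Qᵀ` (`P' = P⁻¹`). -/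
def sandU (P' Q : Matrix (Fin 4) (Fin 4) ℂ) (f : Fin 4 × Fin 4 → ℂ) : Fin 4 × Fin 4 → ℂ :=
  fun b => ∑ κ, ∑ μ, P' κ b.1 * f (κ, μ) * Q b.2 μ

/-- `B`-legs: `V ↦ Q'ᵀ V Rᵀ` (`Q' = Q⁻¹`). -/
def sandV (Q' R : Matrix (Fin 4) (Fin 4) ℂ) (f : Fin 4 × Fin 4 → ℂ) : Fin 4 × Fin 4 → ℂ :=
  fun c => ∑ μ, ∑ ν, Q' μ c.1 * f (μ, ν) * R c.2 ν

/-- The DPS legs over `ℂ` (output pattern carries the `8⁻¹`). -/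
def dpsW (s : MatMulFour48.Index) : Fin 4 × Fin 4 → ℂ := fun a => (8 : ℂ)⁻¹ * (MatMulFour48.W s a : ℂ)
/-- The DPS left factors over `ℂ`. -/
def dpsU (s : MatMulFour48.Index) : Fin 4 × Fin 4 → ℂ := fun b => (MatMulFour48.U s b : ℂ)
/-- The DPS right factors over `ℂ`. -/
def dpsV (s : MatMulFour48.Index) : Fin 4 × Fin 4 → ℂ := fun c => (MatMulFour48.V s c : ℂ)

/-! ## The two stubs -/

/-- STUB 1 (de Groote sandwiching; provable, size M): isotropies transform decompositions of
`⟨4,4,4⟩` into decompositions of `⟨4,4,4⟩`. [cite: doi:10.1016/0304-3975(78)90045-2] -/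
theorem stub_isotropy :
    ∀ (P P' Q Q' R R' : Matrix (Fin 4) (Fin 4) ℂ),
      P * P' = 1 → P' * P = 1 → Q * Q' = 1 → Q' * Q = 1 → R * R' = 1 → R' * R = 1 →
    ∀ (ι : Type) [Fintype ι] (w u v : ι → Fin 4 × Fin 4 → ℂ),
      matMulTensor ℂ 4 4 4 = ∑ s, triad (w s) (u s) (v s) →
      matMulTensor ℂ 4 4 4 = ∑ s, triad (sandW P R' (w s)) (sandU P' Q (u s)) (sandV Q' R (v s)) := by
  sorry

/-- STUB 2 (the ORBIT TEST at `k = 2`; finite, size L): some isotropy and rescalings make all `144`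
transformed Dumas–Pernet–Sedoglavic legs exact `4`-qubit stabilizer states.
[cite: arXiv:2506.13242, §3–4] -/
theorem stub_orbitPoint :
    ∃ (P P' Q Q' R R' : Matrix (Fin 4) (Fin 4) ℂ),
      P * P' = 1 ∧ P' * P = 1 ∧ Q * Q' = 1 ∧ Q' * Q = 1 ∧ R * R' = 1 ∧ R' * R = 1 ∧
      ∃ (α β γ : MatMulFour48.Index → ℂ), ∀ s,
        α s ≠ 0 ∧ β s ≠ 0 ∧ γ s ≠ 0 ∧
        legBits 2 (α s • sandW P R' (dpsW s)) ∈ stabilizerStates (2 + 2) ∧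
        legBits 2 (β s • sandU P' Q (dpsU s)) ∈ stabilizerStates (2 + 2) ∧
        legBits 2 (γ s • sandV Q' R (dpsV s)) ∈ stabilizerStates (2 + 2) := by
  sorry

/-! ## Composition -/

/-- Scalars pull out of all three legs of a triad. [folklore] -/
theorem triad_smul_smul_smul {ι κ μ : Type*} (a b d : ℂ) (w : ι → ℂ) (u : κ → ℂ) (v : μ → ℂ) :
    triad (a • w) (b • u) (d • v) = (a * b * d) • triad w u v := by
  funext x y z
  simp only [triad_apply, Pi.smul_apply, smul_eq_mul]
  ring

/-- **The seed `StabBeatsStrassen` from the line** (`k = 2`, `r = 48 < 49`): DPS decomposition →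
sandwiched (stub 1) → rescaled legs stabilizer (stub 2), rescalings absorbed into the coefficients →
`HasStabilizerScheme 2 48` → the route decl (`hasStabilizerScheme_iff`). -/
theorem StabBeatsStrassen_of : StabBeatsStrassen := by
  classical
  obtain ⟨P, P', Q, Q', R, R', hP, hP', hQ, hQ', hR, hR', α, β, γ, hleg⟩ := stub_orbitPoint
  have hdps : matMulTensor ℂ 4 4 4 = ∑ s, triad (dpsW s) (dpsU s) (dpsV s) :=
    matMulTensor_four_eq_sum_dumasPernetSedoglavic ℂ (by norm_num)
  have hT := stub_isotropy P P' Q Q' R R' hP hP' hQ hQ' hR hR' _ dpsW dpsU dpsV hdps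
  -- rescale every leg and compensate in the coefficient
  have hT' : matMulTensor ℂ 4 4 4 = ∑ s, ((α s)⁻¹ * (β s)⁻¹ * (γ s)⁻¹) •
      triad (α s • sandW P R' (dpsW s)) (β s • sandU P' Q (dpsU s)) (γ s • sandV Q' R (dpsV s)) := by
    rw [hT]
    refine Finset.sum_congr rfl fun s _ => ?_
    obtain ⟨hα, hβ, hγ, -, -, -⟩ := hleg s
    rw [triad_smul_smul_smul, smul_smul]
    have : (α s)⁻¹ * (β s)⁻¹ * (γ s)⁻¹ * (α s * β s * γ s) = 1 := by
      field_simp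
    rw [this, one_smul]
  have h48 : HasStabilizerScheme 2 (Fintype.card MatMulFour48.Index) :=
    hasStabilizerScheme_of_fintype (k := 2) (fun s => (α s)⁻¹ * (β s)⁻¹ * (γ s)⁻¹)
      (fun s => α s • sandW P R' (dpsW s)) (fun s => β s • sandU P' Q (dpsU s))
      (fun s => γ s • sandV Q' R (dpsV s))
      (fun s => ⟨(hleg s).2.2.2.1, (hleg s).2.2.2.2.1, (hleg s).2.2.2.2.2⟩) hT'
  have hcard : Fintype.card MatMulFour48.Index = 48 := by
    simp [MatMulFour48.Index, Fintype.card_prod, Fintype.card_fin]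
  rw [hcard] at h48
  unfold StabBeatsStrassen
  exact ⟨2, 48, by norm_num, (hasStabilizerScheme_iff 2 48).1 h48⟩

end Summit.MatrixMultiplication.MatrixMultiplication.Cruxes.OmegaStabTwo.SeedOrbitTest

end
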